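import Literature.AnabelianGeometry.EtaleTheta.Discharge.Sec5DivTransportAssembly
import Literature.AnabelianGeometry.EtaleTheta.Discharge.Sec5SeedBaseIsoOfCharacteristic

/-!
# [EtTh] §5, Thm. 5.7 anchor at the GENUINE data: G-w5d245-2 assembled with the structural links discharged, and the seeds producer fed by it (p.329 / PDF p.103)

Mochizuki, *The étale theta function …*, Publ. RIMS **45** (2009), proof of Thm. 5.6 p.329 (PDF p.103); Prop. 5.3 (vi) p.326 (PDF p.100)
[cite: MochizukiEtTh2009, Thm 5.6 proof p.329 (PDF p.103); Prop 5.3 (vi) p.326 (PDF p.100)]; [FrdI] Thm. 4.9, Prop. 5.6, Rem. 1.1.1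
[cite: MochizukiFrdI2008, Thm. 4.9 p.88]; [SemiAnbd] Rmk. 3.1.3 [cite: MochizukiSemiAnbd2006, Rmk 3.1.3 p.34].

PROOF-ONLY (0 definitions, no new named fact).  abc-iut cell, layer L2, GAP G-w5d245-2 ASSEMBLY at the genuine §5 data
`ofConnectedTemperoidData` over `B^temp(Π^tp_X)⁰` (seat abc-iut-w5-d245 gen 4).  The generic assembly
`ThetaFrobenioid.exists_aut_div_transport_eq_of_links` (`Sec5DivTransportAssembly.lean`) with its three STRUCTURAL inputs DISCHARGED:
"isomorphisms are isometries" (`hiso` ⟸ [FrdI] Thm. 5.2 (ii), abc-iut-w6-d052's `div_iso_eq_one_of_model`), the section `s^trv_N`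
(`StrvSection` ⟸ abc-iut-L2-t4's `strvSection_ofConnectedTemperoidData`), and the TRANSITIVE torsor law of the Galois object `A_N^bs`
(⟸ abc-iut-L3's `exists_aut_comp_eq_of_isGaloisObj_connectedPart`, [SemiAnbd] Rmk. 3.1.3; `A_N^bs` Galois by the root datum's
`αData.isGalois`):
* `exists_aut_div_transport_eq_of_links_ofConnectedTemperoidData` — `hdivA` at any anchor `α` from {`induced` (LINK (a) = [FrdI] Thm. 4.9
  at `A_⊚`), `hsplit` (Prop. 5.3 (vi)+(i) at `A_⊚`, split form = abc-iut-w6-d043's LINK (c) output), `hdesc` (LINK (b): descent of the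
  root divisors along `φ : A_N → A_⊚`, e.g. `φ := α_N ≫ α_l`), `htf`/`hof` (cancellation laws of `Φ(A_N)`, [FrdI] Def. 2.4 (i))};
* `exists_seeds_hdivcapcup_ofConnectedTemperoidData_of_links` — this seat's seeds producer (`…_of_isTopCharacteristic`, p446646) with
  `hdivA` so DISCHARGED: the anchored capstone's residual {seeds `αs βs`, `hdivcap₁`, `hdivcup₁`} becomes {`hcharN`, `induced`, `hsplit`,
  `hdesc`, `htf`, `hof`} beyond the knit's `h44`/`h3`/`hnd`.
HONEST FRAMING: kernel-checked implications about the §5 data; `induced`/`hsplit`/`hdesc` are NAMED inputs (F-2497 read through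
[FrdI] Thm. 4.9, Prop. 5.3 (vi)(i), the divisor dictionary of the root pair); nothing asserts a result of [EtTh] for an actual curve;
typed ≠ discharged; no side taken on [IUTchIII] Cor. 3.12.
-/

noncomputable section

namespace Literature.AnabelianGeometry.EtaleTheta

open CategoryTheory Opposite Literature.AlgebraicGeometry.Frobenioids Literature.AnabelianGeometry.SemiGraphs
  Literature.AnabelianGeometry.SemiGraphs.GaloisObjects FrobenioidCyclotomicRigidity

universe u₀ v₀ w

namespace ThetaFrobenioid

variable {K : Type u₀} [Field K] {X : SemiGraphs.TemperedArithmeticGroup.{u₀} K} {D₀ : Type u₀} [Category.{v₀} D₀]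
  {V : FrdIMonoidStub.{w}} {T₀ : RealifiedDivisorMonoids (D₀ := D₀) V}
  {VD : FrdICatStub.{u₀ + 1, u₀, w} (ConnectedPart (BTemp X.Pi))}
  {tf : TemperedFrobenioid T₀ (ConnectedPart (BTemp X.Pi)) VD} {hZ : tf.monoidType = MonoidType.Z}
  {hP : ∀ A : (ConnectedPart (BTemp X.Pi))ᵒᵖ, IsPerfect (tf.Φ.carrier A)}
  {NH : Subgroup (Field.absoluteGaloisGroup K) → tf.category → ℕ+ → Prop} {A₀ : tf.category}
  {hA₀ : PreFrobenioid.IsFrobeniusTrivial tf.toElem A₀} {hA₀' : SemiGraphs.IsGaloisObj A₀.base.obj}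
  {lv N : ℕ+} {T : ThetaEnvData.{max u₀ w} N}
  {pullFrac : ∀ {A A' : (BiKummerSetting.mkOfConnectedTemperoid X tf hZ hP NH A₀ hA₀ hA₀').C} (_ : A' ⟶ A),
    (BiKummerSetting.mkOfConnectedTemperoid X tf hZ hP NH A₀ hA₀ hA₀').biratUnits A →
      (BiKummerSetting.mkOfConnectedTemperoid X tf hZ hP NH A₀ hA₀ hA₀').biratUnits A'}
  {θ : (BiKummerSetting.mkOfConnectedTemperoid X tf hZ hP NH A₀ hA₀ hA₀').biratUnits
    (BiKummerSetting.mkOfConnectedTemperoid X tf hZ hP NH A₀ hA₀ hA₀').Aodot}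
  {Bl : (BiKummerSetting.mkOfConnectedTemperoid X tf hZ hP NH A₀ hA₀ hA₀').C}
  {Pl : (BiKummerSetting.mkOfConnectedTemperoid X tf hZ hP NH A₀ hA₀ hA₀').FractionPair θ Bl}
  {Rl : (BiKummerSetting.mkOfConnectedTemperoid X tf hZ hP NH A₀ hA₀ hA₀').NthRoot θ Pl lv pullFrac}
  (h : ModelFrobenioid.Hypotheses tf.divisorMonoid tf.ratFnFunctor)
  (Q : FrobenioidTheta.ThetaSubquotientStub.{w} (ConnectedPart (BTemp X.Pi))) (odd_l : Odd (lv : ℕ))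
  (R : (BiKummerSetting.mkOfConnectedTemperoid X tf hZ hP NH A₀ hA₀ hA₀').NthRoot Rl.root Rl.pair N pullFrac)
  (ιX : T.PiX ≃ₜ* X.Pi) (K' : Type w) [Field K'] (constEmb : K'ˣ →* tf.biratUnitsModel R.BN)
  (constEmb_injective : Function.Injective constEmb)
  (hinvc : ∀ g : Aut R.AN.base,
    pull tf.divisorMonoid g.hom (ModelFrobenioid.div R.pair.num) = ModelFrobenioid.div R.pair.num)
  (hinvp : ∀ y : T.PiX, y ∈ T.PiYdd →
    pull tf.divisorMonoid ((BiKummerSetting.mkOfConnectedTemperoid X tf hZ hP NH A₀ hA₀ hA₀').galoisSurj R.AN.base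
      R.αData.isGalois (ιX y)).hom (ModelFrobenioid.div R.pair.den) = ModelFrobenioid.div R.pair.den)
  (Ψ : (BiKummerSetting.mkOfConnectedTemperoid X tf hZ hP NH A₀ hA₀ hA₀').C ≌
    (BiKummerSetting.mkOfConnectedTemperoid X tf hZ hP NH A₀ hA₀ hA₀').C)
  (ι : Ψ.functor.obj (ofConnectedTemperoidData h Q odd_l R ιX K' constEmb constEmb_injective hinvc hinvp).Acirc ≅
    (ofConnectedTemperoidData h Q odd_l R ιX K' constEmb constEmb_injective hinvc hinvp).Acirc)
  (φ : (ofConnectedTemperoidData h Q odd_l R ιX K' constEmb constEmb_injective hinvc hinvp).AN ⟶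
    (ofConnectedTemperoidData h Q odd_l R ιX K' constEmb constEmb_injective hinvc hinvp).Acirc)
  {eΦ : (ofConnectedTemperoidData h Q odd_l R ιX K' constEmb constEmb_injective hinvc hinvp).PhiAcirc ≃*
    (ofConnectedTemperoidData h Q odd_l R ιX K' constEmb constEmb_injective hinvc hinvp).pre.Mon
      ((ofConnectedTemperoidData h Q odd_l R ιX K' constEmb constEmb_injective hinvc hinvp).base.obj
        (Ψ.functor.obj (ofConnectedTemperoidData h Q odd_l R ιX K' constEmb constEmb_injective hinvc hinvp).Acirc))}
  (induced : (FrobenioidThetaDivisors.DivisorTransportStub.ofThm49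
      (ofConnectedTemperoidData h Q odd_l R ιX K' constEmb constEmb_injective hinvc hinvp)).IsInducedBy Ψ
    (ofConnectedTemperoidData h Q odd_l R ιX K' constEmb constEmb_injective hinvc hinvp).Acirc eΦ)
  (Z₀ W₀ : Algebra.GrothendieckGroup (ofConnectedTemperoidData h Q odd_l R ιX K' constEmb constEmb_injective hinvc hinvp).PhiAcirc)
  (hsplit : ∃ g : Aut (ofConnectedTemperoidData h Q odd_l R ιX K' constEmb constEmb_injective hinvc hinvp).Acirc,
    ThetaFrobenioid.gpMap
        (FrobenioidThetaDivisors.psiPhi (ofConnectedTemperoidData h Q odd_l R ιX K' constEmb constEmb_injective hinvc hinvp) Ψ ι eΦ :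
          (ofConnectedTemperoidData h Q odd_l R ιX K' constEmb constEmb_injective hinvc hinvp).PhiAcirc →*
            (ofConnectedTemperoidData h Q odd_l R ιX K' constEmb constEmb_injective hinvc hinvp).PhiAcirc) Z₀ =
      ThetaFrobenioid.gpMap
        ((ofConnectedTemperoidData h Q odd_l R ιX K' constEmb constEmb_injective hinvc hinvp).pullAut g :
          (ofConnectedTemperoidData h Q odd_l R ιX K' constEmb constEmb_injective hinvc hinvp).PhiAcirc →*
            (ofConnectedTemperoidData h Q odd_l R ιX K' constEmb constEmb_injective hinvc hinvp).PhiAcirc) Z₀ ∧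
    ThetaFrobenioid.gpMap
        (FrobenioidThetaDivisors.psiPhi (ofConnectedTemperoidData h Q odd_l R ιX K' constEmb constEmb_injective hinvc hinvp) Ψ ι eΦ :
          (ofConnectedTemperoidData h Q odd_l R ιX K' constEmb constEmb_injective hinvc hinvp).PhiAcirc →*
            (ofConnectedTemperoidData h Q odd_l R ιX K' constEmb constEmb_injective hinvc hinvp).PhiAcirc) W₀ =
      ThetaFrobenioid.gpMap
        ((ofConnectedTemperoidData h Q odd_l R ιX K' constEmb constEmb_injective hinvc hinvp).pullAut g :
          (ofConnectedTemperoidData h Q odd_l R ιX K' constEmb constEmb_injective hinvc hinvp).PhiAcirc →*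
            (ofConnectedTemperoidData h Q odd_l R ιX K' constEmb constEmb_injective hinvc hinvp).PhiAcirc) W₀)
  {n : ℕ}
  (hdesc : Algebra.GrothendieckGroup.of ((ofConnectedTemperoidData h Q odd_l R ιX K' constEmb constEmb_injective hinvc hinvp).pre.div
        (ofConnectedTemperoidData h Q odd_l R ιX K' constEmb constEmb_injective hinvc hinvp).sCap) ^ n =
      AlgebraicGeometry.Frobenioids.gpMap
        ((ofConnectedTemperoidData h Q odd_l R ιX K' constEmb constEmb_injective hinvc hinvp).pre.pull
          ((ofConnectedTemperoidData h Q odd_l R ιX K' constEmb constEmb_injective hinvc hinvp).base.map φ)) Z₀ ∧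
    Algebra.GrothendieckGroup.of ((ofConnectedTemperoidData h Q odd_l R ιX K' constEmb constEmb_injective hinvc hinvp).pre.div
        (ofConnectedTemperoidData h Q odd_l R ιX K' constEmb constEmb_injective hinvc hinvp).sCup) ^ n =
      AlgebraicGeometry.Frobenioids.gpMap
        ((ofConnectedTemperoidData h Q odd_l R ιX K' constEmb constEmb_injective hinvc hinvp).pre.pull
          ((ofConnectedTemperoidData h Q odd_l R ιX K' constEmb constEmb_injective hinvc hinvp).base.map φ)) W₀)
  (htf : ∀ x y : Algebra.GrothendieckGroup
      ((ofConnectedTemperoidData h Q odd_l R ιX K' constEmb constEmb_injective hinvc hinvp).pre.Mon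
        ((ofConnectedTemperoidData h Q odd_l R ιX K' constEmb constEmb_injective hinvc hinvp).base.obj
          (ofConnectedTemperoidData h Q odd_l R ιX K' constEmb constEmb_injective hinvc hinvp).AN)), x ^ n = y ^ n → x = y)
  (hof : Function.Injective
    (Algebra.GrothendieckGroup.of :
      (ofConnectedTemperoidData h Q odd_l R ιX K' constEmb constEmb_injective hinvc hinvp).pre.Mon
          ((ofConnectedTemperoidData h Q odd_l R ιX K' constEmb constEmb_injective hinvc hinvp).base.obj
            (ofConnectedTemperoidData h Q odd_l R ιX K' constEmb constEmb_injective hinvc hinvp).AN) →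
        Algebra.GrothendieckGroup
          ((ofConnectedTemperoidData h Q odd_l R ιX K' constEmb constEmb_injective hinvc hinvp).pre.Mon
            ((ofConnectedTemperoidData h Q odd_l R ιX K' constEmb constEmb_injective hinvc hinvp).base.obj
              (ofConnectedTemperoidData h Q odd_l R ιX K' constEmb constEmb_injective hinvc hinvp).AN))))

include induced hsplit hdesc htf hof in
/-- **G-w5d245-2 at the genuine data — `hdivA` at any anchor `α`**, the structural links DISCHARGED (`hiso`: [FrdI] Thm. 5.2 (ii);
`StrvSection`: `strvSection_ofConnectedTemperoidData`; transitive torsor law: `A_N^bs` Galois, [SemiAnbd] Rmk. 3.1.3).  Residual: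
`induced` (Thm. 4.9 at `A_⊚`), `hsplit` (Prop. 5.3 (vi)+(i) split), `hdesc` (LINK (b)), `htf`/`hof` (cancellation in `Φ(A_N)`).
[cite: MochizukiEtTh2009, Thm 5.6 proof p.329 (PDF p.103); Prop 5.3 (vi) p.326 (PDF p.100)] -/
theorem exists_aut_div_transport_eq_of_links_ofConnectedTemperoidData
    (α : Ψ.functor.obj (ofConnectedTemperoidData h Q odd_l R ιX K' constEmb constEmb_injective hinvc hinvp).AN ≅
      (ofConnectedTemperoidData h Q odd_l R ιX K' constEmb constEmb_injective hinvc hinvp).AN) :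
    ∃ ε : Aut (ofConnectedTemperoidData h Q odd_l R ιX K' constEmb constEmb_injective hinvc hinvp).AN,
      (ofConnectedTemperoidData h Q odd_l R ιX K' constEmb constEmb_injective hinvc hinvp).pre.div
          (α.inv ≫ Ψ.functor.map (ofConnectedTemperoidData h Q odd_l R ιX K' constEmb constEmb_injective hinvc hinvp).sCap) =
        (ofConnectedTemperoidData h Q odd_l R ιX K' constEmb constEmb_injective hinvc hinvp).pre.div
          (ε.hom ≫ (ofConnectedTemperoidData h Q odd_l R ιX K' constEmb constEmb_injective hinvc hinvp).sCap) ∧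
      (ofConnectedTemperoidData h Q odd_l R ιX K' constEmb constEmb_injective hinvc hinvp).pre.div
          (α.inv ≫ Ψ.functor.map (ofConnectedTemperoidData h Q odd_l R ιX K' constEmb constEmb_injective hinvc hinvp).sCup) =
        (ofConnectedTemperoidData h Q odd_l R ιX K' constEmb constEmb_injective hinvc hinvp).pre.div
          (ε.hom ≫ (ofConnectedTemperoidData h Q odd_l R ιX K' constEmb constEmb_injective hinvc hinvp).sCup) := by
  have hPF := ModelFrobenioid.isPreFrobenioid (DivB := tf.divBNatTrans) h.isMonoidOn h.isDivisorial h.isMonoidOn_rat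
    h.isGroupLike_rat h.isGraphConnected h.isTotallyEpimorphic
  refine (ofConnectedTemperoidData h Q odd_l R ιX K' constEmb constEmb_injective hinvc hinvp).exists_aut_div_transport_eq_of_links
    (div_iso_eq_one_of_model _ rfl hPF)
    (strvSection_ofConnectedTemperoidData h Q odd_l R ιX K' constEmb constEmb_injective hinvc hinvp) (fun a b => ?_) ι α φ induced
    Z₀ W₀ hsplit hdesc htf hof
  obtain ⟨σ, hσ⟩ := exists_aut_comp_eq_of_isGaloisObj_connectedPart R.AN.base _ R.αData.isGalois a b
  exact ⟨σ, hσ.symm⟩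

include induced hsplit hdesc htf hof in
/-- **The seeds `αs, βs` and `hdivcap₁`/`hdivcup₁` of the anchored Thm. 5.7 capstone with `hdivA` DISCHARGED by the G-w5d245-2
assembly** (`Ψ := h44.Ψ`): from `h3` (T44-L05), `Φ` non-dilating, the characteristic clause for `A_N^bs` (`hcharN`), LINK (a)'s
`induced`, the split Prop. 5.3 (vi)+(i) at `A_⊚` (`hsplit`), LINK (b)'s descent (`hdesc`) and the cancellation laws of `Φ(A_N)`.
[cite: MochizukiEtTh2009, Thm 5.6 proof p.329 (PDF p.103); Thm 5.10 (i) p.333 (PDF p.107); Prop 5.3 (vi) p.326 (PDF p.100)] -/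
theorem exists_seeds_hdivcapcup_ofConnectedTemperoidData_of_links
    (h44 : BiKummerSetting.Thm44Hyp (BiKummerSetting.mkOfConnectedTemperoid X tf hZ hP NH A₀ hA₀ hA₀')
      (BiKummerSetting.mkOfConnectedTemperoid X tf hZ hP NH A₀ hA₀ hA₀'))
    (hΨ : h44.Ψ = Ψ) (hnd : IsNonDilatingOn tf.divisorMonoid) (h3 : h44.PreservesFrobeniusStructure)
    (hcharN : IsTopCharacteristic X.Pi (galoisSurjOf X.isTempered R.AN.base.obj R.αData.isGalois).ker) :
    ∃ (αs : Ψ.functor.obj (ofConnectedTemperoidData h Q odd_l R ιX K' constEmb constEmb_injective hinvc hinvp).AN ≅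
        (ofConnectedTemperoidData h Q odd_l R ιX K' constEmb constEmb_injective hinvc hinvp).AN)
      (βs : Ψ.functor.obj (ofConnectedTemperoidData h Q odd_l R ιX K' constEmb constEmb_injective hinvc hinvp).BN ≅
        (ofConnectedTemperoidData h Q odd_l R ιX K' constEmb constEmb_injective hinvc hinvp).BN),
      αs.inv ≫ Ψ.functor.map (ofConnectedTemperoidData h Q odd_l R ιX K' constEmb constEmb_injective hinvc hinvp).sCap ≫ βs.hom =
        (ofConnectedTemperoidData h Q odd_l R ιX K' constEmb constEmb_injective hinvc hinvp).sCap ∧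
      (ofConnectedTemperoidData h Q odd_l R ιX K' constEmb constEmb_injective hinvc hinvp).pre.div
          (αs.inv ≫ Ψ.functor.map (ofConnectedTemperoidData h Q odd_l R ιX K' constEmb constEmb_injective hinvc hinvp).sCap ≫
            βs.hom) =
        (ofConnectedTemperoidData h Q odd_l R ιX K' constEmb constEmb_injective hinvc hinvp).pre.div
          (ofConnectedTemperoidData h Q odd_l R ιX K' constEmb constEmb_injective hinvc hinvp).sCap ∧
      (ofConnectedTemperoidData h Q odd_l R ιX K' constEmb constEmb_injective hinvc hinvp).pre.div
          (αs.inv ≫ Ψ.functor.map (ofConnectedTemperoidData h Q odd_l R ιX K' constEmb constEmb_injective hinvc hinvp).sCup ≫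
            βs.hom) =
        (ofConnectedTemperoidData h Q odd_l R ιX K' constEmb constEmb_injective hinvc hinvp).pre.div
          (ofConnectedTemperoidData h Q odd_l R ιX K' constEmb constEmb_injective hinvc hinvp).sCup := by
  subst hΨ
  exact exists_seeds_hdivcapcup_ofConnectedTemperoidData_of_isTopCharacteristic h Q odd_l R ιX K' constEmb constEmb_injective hinvc
    hinvp h44 hnd h3 hcharN fun α =>
      exists_aut_div_transport_eq_of_links_ofConnectedTemperoidData h Q odd_l R ιX K' constEmb constEmb_injective hinvc hinvp
        h44.Ψ ι φ induced Z₀ W₀ hsplit hdesc htf hof α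

end ThetaFrobenioid

end Literature.AnabelianGeometry.EtaleTheta

end
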